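import Literature.AlgebraicGeometry.VanGeemen1994.WeilTypeHodgeGroupSU
import Literature.AlgebraicGeometry.HodgeTheory.WeilTypeAbelianVariety
import Literature.AlgebraicGeometry.HodgeTheory.WeilTypeHodgeRing
import Literature.AlgebraicGeometry.HodgeTheory.AbelianVarietyPullbackAlgebraicClasses
import HarnessLib

/-!
# Quaternion classes `W_F` and the Hodge ring of a general abelian variety of quaternion type (van Geemen–Verra 2003, §2.1, 4.5–4.9; Abdulali 1999, Thm. 4.1)

research route conditional on HC_CM; not a corollary; Q11.4-sentence-2 already refuted in dim ≥ 3.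
(Cell `pub-hodge-ring2`, seat atlas-2, generation 19: typed Literature skeleton — published statements only,
vendored as one NAMED FACT `VanGeemenVerra2003_quaternionHodgeClasses : Prop` plus definitions and the one
corollary the paper proves in a line (Cor. 4.9). Nothing here asserts the Hodge conjecture or `HC_CM`.)

SOURCE (held: `paper:arxiv-math_0103111`, B. van Geemen, A. Verra, *Quaternionic Pryms and Hodge classes*,
Topology 42 (2003) 35–53 [vanGeemenVerra2003QuaternionicPryms]; page/line locators below are to the arXiv text).
Verbatim:
* 1.1 (p.3): "A definite quaternion algebra `F` over `ℚ` is a skew field with center `ℚ`, of dimension 4 over `ℚ`,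
  such that `F ⊗_ℚ ℝ` is isomorphic to the skew field of Hamilton's quaternions. … one can find elements
  `i, j, k ∈ F` such that `F = ℚ + ℚi + ℚj + ℚk`, `i² = r`, `j² = s`, `ij = -ji = k`, with `r, s ∈ ℚ_{<0}`."
* 2.1 (p.5): "We will say that `(A, E, F)` is a polarized abelian variety of quaternion type if `(A, E)` is a
  polarized abelian variety and if there is a definite quaternion algebra `F` over `ℚ` with `F ⊂ End(A) ⊗ ℚ` in
  such a way that `H₁(A, ℚ)` is a vector space over `F` and `x^*E = x x̄ E`. The last condition is equivalent
  to the condition that the Rosati involution defined by `E` on `End(A)` induces the canonical involution on `F`."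
* 4.4 (p.9): "For a general `2n`-dimensional polarized abelian variety `(A, E)` of Weil type (i.e.
  `Hod(A)(ℂ) ≅ SL(2n, ℂ)`) one has ([vG], Thm. 6.12): `Bⁿ(A) ≅ ⟨∧ⁿE⟩ ⊕ W_K`, `Bⁱ(A) = ⟨∧ⁱE⟩ (i ≠ n)`."
  (the tree's `VanGeemen1994.VanGeemen1994_thm612`, hypothesis `VanGeemen1994.HasHodgeGroupSU`).
* 4.5 Lemma (p.9): "Let `(A, E, F)` be an abelian variety of quaternion type. Let `K ⊂ F` be a quadratic
  extension of `ℚ`. Then `A` is of Weil type for `K`."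
* 4.6 (p.9): "Let `A` be a `2n`-dimensional abelian variety of quaternion type with algebra `F`. We define the
  subspace `W_F ⊂ H^{2n}(A, ℚ)` as the subspace spanned by the translates `x · W_K` where `x` runs over `F` and
  `W_K` is the space of Weil classes for the field `K`."
* 4.7 Proposition (p.9): "The subspace `W_F` does not depend on the choice of the quadratic subfield `K ⊂ F`
  and: `W_F ⊂ H^{2n}(A, ℚ) ∩ H^{n,n}(A)`, `dim_ℚ W_F = 2n + 1`."
* 4.8 (p.10): "For a general polarized `2n`-dimensional abelian variety `(A, E)` of quaternion type (i.e.
  `Hod(A)(ℂ) ≅ SO(2n, ℂ)`) one has ([A], Thm 4.1): `Bⁿ(A) ≅ ⟨∧ⁿE⟩ ⊕ W_F`, `Bⁱ(A) = ⟨∧ⁱE⟩ (i ≠ n)`."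
  ([A] = S. Abdulali, *Abelian varieties of type III and the Hodge conjecture*, Int. J. Math. 10 (1999)
  667–675, Thm. 4.1 [Abdulali1999TypeIII] — not held; cited through [vGV].)
* 4.9 Corollary (p.10): "(Abdulali [A].) Let `A` be an abelian variety of quaternion type. Assume there is a
  quadratic subfield `K ⊂ F` such that the space of Weil classes `W_K` is spanned by cycle classes. Then the space
  of quaternionic classes `W_F` is spanned by cycle classes. This follows from the fact that `W_F` is spanned by
  the translates of `W_K` by elements of `F ⊂ End(A)`."

DICTIONARY (carriers of `HodgeTheory/WeilClasses`, `VanGeemen1994/WeilTypeHodgeGroupSU`, barrier file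
`ExceptionalHodgeClasses`). `F = ℚ⟨φ, χ⟩ ⊂ End(A) ⊗ ℚ` is given by two endomorphisms `φ χ : A ⟶ A` with
`φ² = -a`, `χ² = -b` (`a, b ∈ ℕ`, `0 < a, b`: 1.1 with `i = φ`, `j = χ`, `r = -a`, `s = -b`, after clearing
denominators) and `φχ = -χφ`; then `1, φ, χ, φχ` span the order `ℤ⟨φ, χ⟩ ⊂ F` and `x ↦ x̄` is `φ ↦ -φ`, `χ ↦ -χ`.
The polarization is a rational hyperplane class `h = e^*l` (`e` a projective embedding, `l ≠ 0` rational on `ℙᴺ`;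
`E ∈ ∧²H¹(A, ℚ) = H²(A, ℚ)` IS its class, 2.5), and "`x^*E = x x̄ E`" for the generators reads `φ^*h = a·h`,
`χ^*h = b·h` (equivalently the Rosati involution is `x ↦ x̄` on `F`, 2.1). `W_K ⊗ ℂ = weilClassesOf A ψ n d` for
`K = ℚ(ψ)`, `ψ² = -d` (`HodgeTheory/WeilClasses`, van Geemen 4.9); `W_F ⊗ ℂ = quaternionClasses` (§4.6: the span
of the translates `x^*(W_K ⊗ ℂ)`, `x ∈ ℤ⟨φ, χ⟩` — translating by `x/m` gives the same line as by `x`);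
`Bᵖ(A) ⊗ ℂ = VanGeemen1994.hodgeClassSpan A.dim A.X p`, `⟨∧ᵖE⟩ ⊗ ℂ ⊆ Dᵖ ⊗ ℂ = divisorClassesSpan A.X A.dim p`
(so "`Bⁱ = ⟨∧ⁱE⟩`" is vendored in the weaker form `Bⁱ ⊗ ℂ = Dⁱ ⊗ ℂ`, exactly as `VanGeemen1994_thm612` (iii)
vendors [vG] 6.12). "GENERAL … (i.e. `Hod(A)(ℂ) ≅ SO(2n, ℂ)`)": the Hodge group of `A` commutes with `End(A)`
and preserves `E`, so `Hod(A) ⊆ G_F := Aut_F(H₁(A, ℚ), E)`, the group of the PEL family of `(A, E, F)` (2.2;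
[Abdulali2002TypeIII] §4: "`Ĝ := Aut_D(V, T)⁰` … The resulting Kuga fiber variety is a PEL-family"), with
`G_F(ℂ) ≅ O(2n, ℂ)` (`H¹(A, ℂ) = W ⊗ U` as `F ⊗ ℂ ≅ M₂(ℂ)`-module, `E = q ⊗ ε` with `q` symmetric on the
`2n`-space `W`); `Hod(A)` being connected, "`Hod(A)(ℂ) ≅ SO(2n, ℂ) = G_F(ℂ)⁰`" is "`Hod(A) = Ĝ`", Abdulali's
"general member of a PEL-family" ([Abdulali2002TypeIII] Prop. 2.3.1: "the Hodge group of a general fiber equals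
`ρ(G)`"; [Abdulali2016TateTwists] §2.6: "a simple abelian variety is of PEL-type if and only if it is a general
member of a PEL-family"), and a closed subgroup of an algebraic group is of finite index iff it contains the
identity component ([Borel1991] I.1.2). ON THE CARRIERS (degree one, `ℂ`-points, as in `HasHodgeGroupSU`):
`G_F(ℂ) = quaternionGroup A φ χ n h := U_h(φ) ⊓ U_h(χ)` (the automorphisms of `H¹(A(ℂ); ℂ)` commuting with
`φ^*` and `χ^*` and preserving the pairing `Q_{h,2n-1}`; `VanGeemen1994.weilUnitaryGroup`), and
`IsGeneralQuaternionType A φ χ n h :=` "`Hg(A)(ℂ)₁ = VanGeemen1994.hodgeGroupOne A.dim A.X` is a subgroup of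
finite index of `quaternionGroup A φ χ n h`".

WHAT IS VENDORED AS A FACT (one `def … : Prop`, no axiom): for `(A, φ, χ, a, b, e, l)` as above with
`dim A = 2n`, `2 ≤ n`: (4.5) `(A, ℚ(φ))` and `(A, ℚ(χ))` are of Weil type — the planes `W_{ℚ(φ)} ⊗ ℂ`,
`W_{ℚ(χ)} ⊗ ℂ` are of Hodge type `(n, n)`; (4.7) `W_F ⊗ ℂ` is the same for `K = ℚ(φ)` and `K = ℚ(χ)`, lies in
`Bⁿ ⊗ ℂ`, and has dimension `2n + 1`; (4.8) if `A` is general, `Bᵖ ⊗ ℂ = Dᵖ ⊗ ℂ` for `p ≠ n` and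
`Bⁿ ⊗ ℂ = (Dⁿ ⊗ ℂ) ⊕ (W_F ⊗ ℂ)`. (`2 ≤ n`: for `n = 1` the weaker reading `D¹ = B¹` would make the last direct
sum false; the paper's range of interest is `n = 4`, the cell's is `n = 3`.) PROVED HERE: Cor. 4.9 in carrier
form (`quaternionClasses_le_algebraicClasses`: translates of algebraic classes by endomorphisms are algebraic,
`HodgeTheory.map_mem_algebraicClasses_of_abelianVariety`, Fulton Cor. 19.2 (b)), and the unfolding of the fact
into the generation statement "every rational `(p,p)` class lies in `Dᵖ ⊗ ℂ` (`p ≠ n`), resp. in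
`Dⁿ ⊗ ℂ + W_F ⊗ ℂ`" used Summit-side by the cell `pub-hodge-ring2` (row `g6.III(1)`: simple abelian sixfolds with
definite quaternion multiplication, `n = 3`, where `dim B³ = 8 = 1 + 7`).

NOT VENDORED: the identification `hodgeGroupOne = Hg(A)(ℂ)|_{H¹}` is the one asserted in
`VanGeemen1994/WeilTypeHodgeGroupSU` (Deligne's characterisation of the Hodge group as the stabiliser of the Hodge
classes on all powers); that EVERY simple type III sixfold with `End ⊗ ℚ = F` is general (`SO(6)` has no proper
connected irreducible orthogonal subgroup) is a remark of the cell's records, not of the sources, and is NOT stated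
here; [Abdulali2002TypeIII] Thm. 4.1 / Rem. 5.4 (usual HC for such `A` ⇒ general HC for all powers when `disc T`
is not a square, automatic for odd `m`) is recorded in the cell, not typed.

References: [vanGeemenVerra2003QuaternionicPryms] 1.1, 2.1, 2.2, 2.5, 4.2–4.9; [Abdulali1999TypeIII] Thm. 4.1;
[Abdulali2002TypeIII] §2.3 Prop. 2.3.1, §4, Thm. 4.1, Rem. 5.4; [Abdulali2016TateTwists] §2.6;
[vanGeemen1994HodgeAV] 2.1, 2.4, 4.9, 6.4–6.12; [Borel1991] I.1.2; [Fulton1998] Cor. 19.2 (b).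
-/

noncomputable section

open CategoryTheory
open Literature.AlgebraicTopology.SingularHomology
open Literature.AlgebraicGeometry.HodgeTheory
open Literature.AlgebraicGeometry Literature.AlgebraicGeometry.Motives
open Literature.Barriers.HodgeConjecture (divisorClassesSpan)
open Literature.AlgebraicGeometry.VanGeemen1994 (hodgeGroupOne weilUnitaryGroup hodgeClassSpan pullbackOne)

namespace Literature.AlgebraicGeometry.VanGeemenVerra2003

/-! ### The order `ℤ⟨φ, χ⟩ ⊂ F` and the quaternion classes `W_F ⊗ ℂ` -/

section QuaternionClasses

variable (A : AbelianVariety ℂ) (φ χ : A ⟶ A)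

/-- The element `q₀ + q₁ φ + q₂ χ + q₃ φχ` of the order `ℤ⟨φ, χ⟩ = ℤ + ℤi + ℤj + ℤk ⊂ F ⊂ End(A) ⊗ ℚ`
(`i = φ`, `j = χ`, `k = ij`), as an endomorphism of `A`. [cite: vanGeemenVerra2003QuaternionicPryms, 1.1 and 2.1] -/
def quaternionElement (q : Fin 4 → ℤ) : A ⟶ A :=
  q 0 • 𝟙 A + q 1 • φ + q 2 • χ + q 3 • (φ ≫ χ)

/-- **`W_F ⊗ ℂ ⊆ H^{2n}(A(ℂ); ℂ)` — the quaternion classes** (van Geemen–Verra 4.6): the span of the translates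
`x^*(W_K ⊗ ℂ)` of the complexified space of Weil classes `W_K ⊗ ℂ = weilClassesOf A ψ n d` of the quadratic
field `K = ℚ(ψ) ⊂ F` (`ψ² = -d`) by the elements `x` of the order `ℤ⟨φ, χ⟩` of `F` ("the subspace spanned by the
translates `x · W_K` where `x` runs over `F`"; `x` and `x/m` give the same translate).
[cite: vanGeemenVerra2003QuaternionicPryms, 4.6 and 4.3] [cite: vanGeemen1994HodgeAV, 4.9] -/
def quaternionClasses (ψ : A ⟶ A) (n d : ℕ) : Submodule ℂ (complexBetti A.X (2 * n)) :=
  ⨆ q : Fin 4 → ℤ,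
    (weilClassesOf A ψ n d).map (complexBetti.map (quaternionElement A φ χ q).hom.hom.hom (2 * n)).hom

variable {A φ χ}

/-- Each translate `x^*(W_K ⊗ ℂ)`, `x ∈ ℤ⟨φ, χ⟩`, lies in `W_F ⊗ ℂ` (definitional).
[cite: vanGeemenVerra2003QuaternionicPryms, 4.6] -/
theorem map_weilClassesOf_le_quaternionClasses (ψ : A ⟶ A) (n d : ℕ) (q : Fin 4 → ℤ) :
    (weilClassesOf A ψ n d).map (complexBetti.map (quaternionElement A φ χ q).hom.hom.hom (2 * n)).hom ≤
      quaternionClasses A φ χ ψ n d :=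
  le_iSup (fun q : Fin 4 → ℤ ↦
    (weilClassesOf A ψ n d).map (complexBetti.map (quaternionElement A φ χ q).hom.hom.hom (2 * n)).hom) q

/-- `W_K ⊗ ℂ ⊆ W_F ⊗ ℂ` (the translate by `x = 1`). [cite: vanGeemenVerra2003QuaternionicPryms, 4.6] -/
theorem weilClassesOf_le_quaternionClasses (ψ : A ⟶ A) (n d : ℕ) :
    weilClassesOf A ψ n d ≤ quaternionClasses A φ χ ψ n d := by
  have h1 : quaternionElement A φ χ (fun i ↦ if i = 0 then 1 else 0) = 𝟙 A := by
    simp [quaternionElement]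
  have hid : (complexBetti.map (quaternionElement A φ χ (fun i ↦ if i = 0 then 1 else 0)).hom.hom.hom
      (2 * n)).hom = LinearMap.id := by
    rw [h1]
    exact congrArg (fun f ↦ f.hom) (complexBetti.map_id (X := A.X) (2 * n))
  have := map_weilClassesOf_le_quaternionClasses (φ := φ) (χ := χ) ψ n d (fun i ↦ if i = 0 then 1 else 0)
  rwa [hid, Submodule.map_id] at this

/-- `W_F ⊗ ℂ` is contained in the span of ALL `End(A)`-translates of `W_K ⊗ ℂ` (the order `ℤ⟨φ, χ⟩` sits in
`End(A)`); equality holds when `End(A) ⊗ ℚ = F`. [cite: vanGeemenVerra2003QuaternionicPryms, 4.6] -/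
theorem quaternionClasses_le_iSup_map (ψ : A ⟶ A) (n d : ℕ) :
    quaternionClasses A φ χ ψ n d ≤
      ⨆ x : A ⟶ A, (weilClassesOf A ψ n d).map (complexBetti.map x.hom.hom.hom (2 * n)).hom :=
  iSup_le fun q ↦ le_iSup (fun x : A ⟶ A ↦
    (weilClassesOf A ψ n d).map (complexBetti.map x.hom.hom.hom (2 * n)).hom) (quaternionElement A φ χ q)

/-- **Corollary 4.9 (Abdulali), carrier form: if `W_K ⊗ ℂ` consists of algebraic classes then so does
`W_F ⊗ ℂ`** — "`W_F` is spanned by the translates of `W_K` by elements of `F ⊂ End(A)`", and the pull-back of an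
algebraic class along an endomorphism of the abelian variety is algebraic (Fulton, Cor. 19.2 (b):
`HodgeTheory.map_mem_algebraicClasses_of_abelianVariety`).
[cite: vanGeemenVerra2003QuaternionicPryms, Cor. 4.9] [cite: Fulton1998, §19.2 Cor. 19.2 (b)] -/
theorem quaternionClasses_le_algebraicClasses (ψ : A ⟶ A) (n d : ℕ)
    (hW : weilClassesOf A ψ n d ≤ algebraicClasses A.X n) :
    quaternionClasses A φ χ ψ n d ≤ algebraicClasses A.X n := by
  refine iSup_le fun q ↦ Submodule.map_le_iff_le_comap.2 fun w hw ↦ ?_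
  exact map_mem_algebraicClasses_of_abelianVariety
    (AbelianVariety.isSmoothProjective_holds : IsSmoothProjective A.dim A.X) A
    (quaternionElement A φ χ q).hom.hom.hom (hW hw)

/-- Corollary 4.9 with the Weil-type input in the tree's rational form: under Weil type `(A, ℚ(ψ))`, if the
rational `(n,n)` classes of `W_K ⊗ ℂ` are algebraic then `W_F ⊗ ℂ ⊆ N ⊗ ℂ` (the plane is spanned by its rational
classes, van Geemen Lemma 5.2 (3): `IsWeilType.weilClassesOf_le_algebraicClasses`).
[cite: vanGeemenVerra2003QuaternionicPryms, Cor. 4.9] [cite: vanGeemen1994HodgeAV, Lemma 5.2 (3)] -/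
theorem quaternionClasses_le_algebraicClasses_of_isWeilType {ψ : A ⟶ A} {n d : ℕ} (h : IsWeilType A ψ n d)
    (hW : ∀ c ∈ weilClassesOf A ψ n d, IsRationalClass c → IsOfHodgeType (2 * n) A.X (2 * n) n n c →
      c ∈ algebraicClasses A.X n) :
    quaternionClasses A φ χ ψ n d ≤ algebraicClasses A.X n :=
  quaternionClasses_le_algebraicClasses ψ n d (fun _ hw ↦ h.weilClassesOf_le_algebraicClasses hW hw)

end QuaternionClasses

/-! ### `G_F(ℂ)` and "general" on the degree-one carriers -/

section General

variable (A : AbelianVariety ℂ) (φ χ : A ⟶ A) (n : ℕ) (h : complexBetti A.X 2)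

/-- **`G_F(ℂ) = Aut_F(H¹(A(ℂ); ℂ), Q_h)`** — the `ℂ`-points of the group of the PEL family of `(A, E, F)`: the
automorphisms of `H¹(A(ℂ); ℂ)` commuting with `φ^*` and `χ^*` (hence with all of `F ⊗ ℂ`) and preserving the
polarization pairing `Q_{h,2n-1}` — the intersection of van Geemen's `U_H(ℂ)` for `K = ℚ(φ)` and for `K = ℚ(χ)`
(`VanGeemen1994.weilUnitaryGroup`). For `dim A = 2n` it is `O(q) ≅ O(2n, ℂ)` on `H¹ = W ⊗ U`; Abdulali's
`Aut_D(V, T)`, whose identity component `Ĝ` is the group of the PEL family.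
[cite: vanGeemenVerra2003QuaternionicPryms, 2.2 and 4.8] [cite: Abdulali2002TypeIII, §4] [cite: vanGeemen1994HodgeAV, 6.9] -/
def quaternionGroup : Subgroup (complexBetti A.X 1 ≃ₗ[ℂ] complexBetti A.X 1) :=
  weilUnitaryGroup A φ n h ⊓ weilUnitaryGroup A χ n h

variable {A φ χ n h} in
/-- Membership in `G_F(ℂ)`, unfolded. [cite: vanGeemenVerra2003QuaternionicPryms, 2.2] [cite: vanGeemen1994HodgeAV, 6.9] -/
theorem mem_quaternionGroup_iff {u : complexBetti A.X 1 ≃ₗ[ℂ] complexBetti A.X 1} :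
    u ∈ quaternionGroup A φ χ n h ↔
      (∀ x, u (pullbackOne A φ x) = pullbackOne A φ (u x)) ∧
        (∀ x, u (pullbackOne A χ x) = pullbackOne A χ (u x)) ∧
        ∀ x y, polarizationPairingOne A.X h (2 * n - 1) (u x) (u y) =
          polarizationPairingOne A.X h (2 * n - 1) x y := by
  simp only [quaternionGroup, Subgroup.mem_inf, VanGeemen1994.mem_weilUnitaryGroup_iff]
  exact ⟨fun ⟨⟨h₁, h₂⟩, h₃, _⟩ ↦ ⟨h₁, h₃, h₂⟩, fun ⟨h₁, h₃, h₂⟩ ↦ ⟨⟨h₁, h₂⟩, h₃, h₂⟩⟩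

/-- **"`A` is a GENERAL polarized abelian variety of quaternion type (i.e. `Hod(A)(ℂ) ≅ SO(2n, ℂ)`)"** (van
Geemen–Verra 4.8) = "`A` is a general member of its PEL-family", `Hod(A) = Ĝ = Aut_D(V, T)⁰` (Abdulali 2002
§4 with Prop. 2.3.1; survey §2.6), on the degree-one carriers: the Hodge group `Hg(A)(ℂ)|_{H¹} = hodgeGroupOne`
(always inside `G_F(ℂ)`, being in the centraliser of `End(A)` and fixing `E`) is a subgroup of FINITE INDEX of
`G_F(ℂ) ≅ O(2n, ℂ)` — for the connected `Hod(A)` this says `Hod(A)_ℂ = G_F,ℂ⁰ ≅ SO(2n, ℂ)` (a closed subgroup is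
of finite index iff it contains the identity component). [cite: vanGeemenVerra2003QuaternionicPryms, 4.8]
[cite: Abdulali2002TypeIII, §4 and Prop. 2.3.1] [cite: Abdulali2016TateTwists, §2.6] [cite: Borel1991, I.1.2] -/
def IsGeneralQuaternionType : Prop :=
  hodgeGroupOne A.dim A.X ≤ quaternionGroup A φ χ n h ∧
    (hodgeGroupOne A.dim A.X).relIndex (quaternionGroup A φ χ n h) ≠ 0

variable {A φ χ n h} in
/-- Unfolding `IsGeneralQuaternionType`. [cite: vanGeemenVerra2003QuaternionicPryms, 4.8] -/
theorem isGeneralQuaternionType_iff :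
    IsGeneralQuaternionType A φ χ n h ↔
      hodgeGroupOne A.dim A.X ≤ quaternionGroup A φ χ n h ∧
        (hodgeGroupOne A.dim A.X).relIndex (quaternionGroup A φ χ n h) ≠ 0 :=
  Iff.rfl

end General

/-! ### The named fact: Lemma 4.5, Proposition 4.7 and §4.8 ([A] Thm. 4.1) -/

section Fact

/-- **Van Geemen–Verra 2003, Lemma 4.5 + Proposition 4.7 + §4.8 (Abdulali 1999, Thm. 4.1), vendored as a named
fact.** For a complex abelian variety `A` of dimension `2n` (`n ≥ 2`) with endomorphisms `φ, χ` satisfying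
`φ² = -a`, `χ² = -b` (`a, b ≥ 1`), `φχ = -χφ` — so `F = ℚ⟨φ, χ⟩ ⊂ End(A) ⊗ ℚ` is the definite quaternion algebra
`(-a, -b)_ℚ` and `H₁(A, ℚ)` an `F`-vector space — and a rational hyperplane class `h = e^*l ≠ 0` with
`φ^*h = a h`, `χ^*h = b h` ("`x^*E = x x̄ E`": `(A, E_h, F)` is a polarized abelian variety of quaternion type, 2.1):
(4.5) `(A, ℚ(φ))` and `(A, ℚ(χ))` are of Weil type: the planes `W_{ℚ(φ)} ⊗ ℂ`, `W_{ℚ(χ)} ⊗ ℂ` are of Hodge type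
`(n, n)`; (4.7) `W_F ⊗ ℂ` built from `K = ℚ(φ)` equals the one built from `K = ℚ(χ)`, lies in `Bⁿ ⊗ ℂ`, and
`dim_ℂ (W_F ⊗ ℂ) = 2n + 1`; (4.8) if moreover `A` is GENERAL (`Hod(A)(ℂ) ≅ SO(2n, ℂ)`,
`IsGeneralQuaternionType`), then `Bᵖ ⊗ ℂ = Dᵖ ⊗ ℂ` for `p ≠ n` ("`Bⁱ = ⟨∧ⁱE⟩`", with `⟨∧ⁱE⟩ ⊆ Dⁱ ⊆ Bⁱ`) and
`Bⁿ ⊗ ℂ = (Dⁿ ⊗ ℂ) ⊕ (W_F ⊗ ℂ)` ("`Bⁿ ≅ ⟨∧ⁿE⟩ ⊕ W_F`"; `Dⁿ = ⟨∧ⁿE⟩` as `B¹ = ⟨E⟩`, `n ≠ 1`). A THEOREM in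
print (4.5: the eigenspaces of `x ∈ K` on `T₀A` are permuted by `j`; 4.7: `W_F ⊗ ℂ = V_{2n+1}`, the
`GL₂(ℂ) = (F ⊗ ℂ)^*`-isotypic summand of `∧^{2n}H¹`; 4.8: invariant theory of `SO(2n)` on `∧•(W ⊗ U)`, [A] Thm. 4.1).
[cite: vanGeemenVerra2003QuaternionicPryms, Lemma 4.5, Prop. 4.7 and 4.8] [cite: Abdulali1999TypeIII, Thm. 4.1] -/
def VanGeemenVerra2003_quaternionHodgeClasses : Prop :=
  ∀ (A : AbelianVariety ℂ) (φ χ : A ⟶ A) (n a b : ℕ) (e : ProjectiveEmbedding A.X)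
    (l : complexBetti (projectiveSpace e.n ℂ) 2),
    2 ≤ n → 0 < a → 0 < b → A.dim = 2 * n →
    φ ≫ φ = -(a • 𝟙 A) → χ ≫ χ = -(b • 𝟙 A) → φ ≫ χ = -(χ ≫ φ) →
    IsRationalClass l → l ≠ 0 →
    complexBetti.map φ.hom.hom.hom 2 (complexBetti.map e.ι 2 l) = (a : ℂ) • complexBetti.map e.ι 2 l →
    complexBetti.map χ.hom.hom.hom 2 (complexBetti.map e.ι 2 l) = (b : ℂ) • complexBetti.map e.ι 2 l →
    (∀ c ∈ weilClassesOf A φ n a, IsOfHodgeType (2 * n) A.X (2 * n) n n c) ∧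
      (∀ c ∈ weilClassesOf A χ n b, IsOfHodgeType (2 * n) A.X (2 * n) n n c) ∧
      quaternionClasses A φ χ φ n a = quaternionClasses A φ χ χ n b ∧
      quaternionClasses A φ χ φ n a ≤ hodgeClassSpan A.dim A.X n ∧
      Module.finrank ℂ (quaternionClasses A φ χ φ n a) = 2 * n + 1 ∧
      (IsGeneralQuaternionType A φ χ n (complexBetti.map e.ι 2 l) →
        (∀ p : ℕ, p ≠ n → hodgeClassSpan A.dim A.X p = divisorClassesSpan A.X A.dim p) ∧
          hodgeClassSpan A.dim A.X n = divisorClassesSpan A.X A.dim n ⊔ quaternionClasses A φ χ φ n a ∧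
          Disjoint (divisorClassesSpan A.X A.dim n) (quaternionClasses A φ χ φ n a))

variable {A : AbelianVariety ℂ} {φ χ : A ⟶ A} {n a b : ℕ}

/-- **Lemma 4.5 from the fact: `(A, ℚ(φ))` is of Weil type `(n, a)`** in the tree's sense
(`HodgeTheory.IsWeilType`, van Geemen 4.9: `0 < n`, `0 < a`, `dim A = 2n`, `φ² = -a`, `W_K ⊗ ℂ` of type `(n,n)`).
[cite: vanGeemenVerra2003QuaternionicPryms, Lemma 4.5] [cite: vanGeemen1994HodgeAV, 4.9] -/
theorem VanGeemenVerra2003_quaternionHodgeClasses.isWeilType (h47 : VanGeemenVerra2003_quaternionHodgeClasses)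
    (e : ProjectiveEmbedding A.X) {l : complexBetti (projectiveSpace e.n ℂ) 2} (hn : 2 ≤ n) (ha : 0 < a)
    (hb : 0 < b) (hA : A.dim = 2 * n) (hφ : φ ≫ φ = -(a • 𝟙 A)) (hχ : χ ≫ χ = -(b • 𝟙 A))
    (hφχ : φ ≫ χ = -(χ ≫ φ)) (hl : IsRationalClass l) (hl0 : l ≠ 0)
    (hEφ : complexBetti.map φ.hom.hom.hom 2 (complexBetti.map e.ι 2 l) = (a : ℂ) • complexBetti.map e.ι 2 l)
    (hEχ : complexBetti.map χ.hom.hom.hom 2 (complexBetti.map e.ι 2 l) = (b : ℂ) • complexBetti.map e.ι 2 l) :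
    IsWeilType A φ n a :=
  isWeilType_iff_weilPlane.2 ⟨by omega, ha, hA, hφ,
    (h47 A φ χ n a b e l hn ha hb hA hφ hχ hφχ hl hl0 hEφ hEχ).1⟩

/-- **§4.8 from the fact, unfolded to classes (the generation statement): for a general polarized abelian
variety of quaternion type, every rational `(p,p)` class lies in `Dᵖ ⊗ ℂ` for `p ≠ n`, and every rational
`(n,n)` class lies in `Dⁿ ⊗ ℂ + W_F ⊗ ℂ`** — so the algebraicity of all Hodge classes of `A` reduces to
Lefschetz `(1,1)` and the algebraicity of ONE Weil plane `W_K` (Cor. 4.9).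
[cite: vanGeemenVerra2003QuaternionicPryms, 4.8 and Cor. 4.9] [cite: Abdulali1999TypeIII, Thm. 4.1] -/
theorem VanGeemenVerra2003_quaternionHodgeClasses.divisorQuaternionGenerated
    (h47 : VanGeemenVerra2003_quaternionHodgeClasses)
    (e : ProjectiveEmbedding A.X) {l : complexBetti (projectiveSpace e.n ℂ) 2} (hn : 2 ≤ n) (ha : 0 < a)
    (hb : 0 < b) (hA : A.dim = 2 * n) (hφ : φ ≫ φ = -(a • 𝟙 A)) (hχ : χ ≫ χ = -(b • 𝟙 A))
    (hφχ : φ ≫ χ = -(χ ≫ φ)) (hl : IsRationalClass l) (hl0 : l ≠ 0)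
    (hEφ : complexBetti.map φ.hom.hom.hom 2 (complexBetti.map e.ι 2 l) = (a : ℂ) • complexBetti.map e.ι 2 l)
    (hEχ : complexBetti.map χ.hom.hom.hom 2 (complexBetti.map e.ι 2 l) = (b : ℂ) • complexBetti.map e.ι 2 l)
    (hgen : IsGeneralQuaternionType A φ χ n (complexBetti.map e.ι 2 l)) :
    (∀ (p : ℕ) (c : complexBetti A.X (2 * p)), p ≠ n → IsRationalClass c →
        IsOfHodgeType A.dim A.X (2 * p) p p c → c ∈ divisorClassesSpan A.X A.dim p) ∧
      ∀ c : complexBetti A.X (2 * n), IsRationalClass c → IsOfHodgeType A.dim A.X (2 * n) n n c →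
        c ∈ divisorClassesSpan A.X A.dim n ⊔ quaternionClasses A φ χ φ n a := by
  obtain ⟨-, -, -, -, -, h48⟩ := h47 A φ χ n a b e l hn ha hb hA hφ hχ hφχ hl hl0 hEφ hEχ
  obtain ⟨hBD, hBn, -⟩ := h48 hgen
  refine ⟨fun p c hp hc hpp ↦ ?_, fun c hc hpp ↦ ?_⟩
  · rw [← hBD p hp]
    exact Submodule.subset_span ⟨hc, hpp⟩
  · rw [← hBn]
    exact Submodule.subset_span ⟨hc, hpp⟩

end Fact

end Literature.AlgebraicGeometry.VanGeemenVerra2003
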